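import Summits.Ventures.HSemireg.MethodInstanceG6ThetaSecantReach
import Mathlib.NumberTheory.LegendreSymbol.Basic
import Mathlib.RingTheory.Int.Basic
import Mathlib.RingTheory.Coprime.Lemmas
import Mathlib.Data.Nat.Prime.Int
import HarnessLib

/-!
# Venture HSemireg — the REACH LAW of the g = 6 theta-secant method instance: `ℚ(√-d)` is reached iff the fundamental solution of
# `x² − d·y² = 1` has `y` odd; WHICH parameters `m` reach it; and an infinite family beyond the table — every PRIME `p ≡ 3 (mod 4)`

HONEST FRAMING. Lean index of the computation cell `pub-hsemireg` (seat p8, «Sunday typer § g = 6»; sequel of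
`MethodInstanceG6ThetaSecantReach.lean`, which holds the 22 Pell witnesses `d ≤ 119`, the mod-4 law and the NO-list `d ∈ {39, 55, 95, 111}`).
ELEMENTARY NUMBER THEORY (structure of the Pell solution set, Mathlib `Pell.IsFundamental`) and two compositions with the landed cell
theorem; no variety, sheaf or `Ext` group is constructed; the theta-secant rows enter BY VALUE exactly as in the predecessor file. Nothing here
says HC, HC_CM or HC_AV is proved; the sixfold components concerned are SPLIT ones (method instances; the verdict's deciding rows stay
«NO-in-families-tried», candidates 0).

THE SENTENCE OF RECORD made kernel (`step0/THETA-SECANT-p1.md` v2.6 §1 «COVERAGE (Pell)», census `target-g6/CENSUS.md` row D-2 REACH cell):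
«`K = ℚ(√-d)`, `d ≡ 3 (4)` squarefree, is reached by some `𝓕_m` iff `m² − d·k² = 1` has a solution with `k` odd (then `m` is even) iff the
fundamental solution of `x² − dy² = 1` has `y` odd». The predecessor file checked this for 26 values of `d`; here it is a THEOREM for every `d`:

* §1 PARITY: for odd `d` every solution of `x² − d·y² = 1` has `x` even ⟺ `y` odd (`pell_even_x_iff_odd_y`); for even `d` every `x` is odd.
* §2 THE LAW: for odd `d` with fundamental solution `a₁`, «some solution has `x` even» ⟺ «`a₁.x` even» ⟺ «`a₁.y` odd»
  (`pell_exists_even_x_iff_isFundamental`), in the cell's ℕ-currency «`∃ m` even, `m² = d·k² + 1`» ⟺ «`a₁.y` odd»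
  (`thetaSecant_reach_iff_odd_fundamental_y`); the least reaching parameter is the fundamental `x₁` (`thetaSecant_fundamental_x_le_of_reach` — why
  p1's table prints `m = 170` for `d = 19`); for `d ≡ 3 (mod 4)` a fundamental solution exists (`pell_exists_isFundamental_of_mod_four_eq_three`),
  so the printed criterion holds verbatim (`thetaSecant_reach_iff_exists_oddFundamental`).
* §3 WHICH `m`: if `x₁` is even, the solutions with even `x` are exactly `± a₁ⁿ` with `n` ODD (`pell_even_x_pow_iff`, `pell_even_x_zpow_iff`,
  `pell_even_x_iff_odd_exponent`) — the reaching parameters of `ℚ(√-d)` are `m = x_n(d)`, `n` odd.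
* §4 BEYOND THE TABLE, an infinite family with NO computation: for every PRIME `p ≡ 3 (mod 4)` the fundamental solution has `x` even
  (`pell_even_x_of_isFundamental_of_prime`; classical descent on `(x − 1)(x + 1) = p·y²`: the coprime halves are `p·a², b²` — a smaller
  solution `b² − p·a² = 1`, contradiction — or `a², p·b²` — then `a² ≡ -1 (mod p)`, impossible for `p ≡ 3 (mod 4)`,
  Mathlib `ZMod.mod_four_ne_three_of_sq_eq_neg_one`), hence `ℚ(√-p)` IS reached (`thetaSecant_reaches_prime`): `p = 127, 131, 139, 151, …`
  (`thetaSecant_reaches_primes_beyond_table`). Consistent with the table: its 15 primes `3, 7, 11, 19, …, 103, 107` are all YES; its four NO values are composite.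
* §5 COMPOSITIONS with the landed cell theorem, under `weilFamilyReach_hyperbolic` ∧ `PerfectComplexRankTransfer C` BY NAME and the m-UNIFORM seed
  hypothesis `hrow` BY VALUE (tier exactly as in the predecessor's `weilAlgebraicAll_two_pellList_…`: rows of record `m ≤ 10`, rank run at
  `m = 24, 170`, an EXTRAPOLATION of the m-uniform mechanism elsewhere, labelled so): the Weil classes of every `ℚ(√-d)`-Weil abelian FOURFOLD
  are algebraic whenever the fundamental `y₁(d)` is odd (`…_of_oddFundamental`), in particular for every prime `d = p ≡ 3 (mod 4)` (`…_prime`).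
  In print every such `d` is [Markman2025SecantWeil] Cor. 1.6.1 (PREPRINT), `d = 3` refereed ([Schoen1988HodgeWeil]); nothing new is claimed
  about Weil classes — the point is the exact REACH of the cell's own g = 6 object, now closed-form.
0 `def`, 0 `sorry`, 0 new named fact.
-/

noncomputable section

open CategoryTheory AlgebraicGeometry
open Literature.AlgebraicGeometry.Motives Literature.AlgebraicGeometry.HodgeTheory
open Literature.AlgebraicGeometry.ModuliOfAbelianVarieties Literature.AlgebraicGeometry.Deligne1982
open Literature.AlgebraicGeometry.KTheory
open Literature.AlgebraicTopology.SingularHomology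

namespace Summit.Ventures.HSemireg

section PellLaw

open Pell

/-! ## §1 Parity of Pell solutions -/

/-- **Odd `d`: `x` is even iff `y` is odd**, for every solution of `x² − d·y² = 1` (`x² = 1 + d·y²`: `y` odd ⟹ right side even ⟹ `x` even;
`y` even ⟹ right side odd ⟹ `x` odd). [bookkeeping] -/
theorem pell_even_x_iff_odd_y {d : ℤ} (hd : Odd d) (a : Solution₁ d) : Even a.x ↔ Odd a.y := by
  have h : Even (a.x ^ 2) ↔ Even (1 + d * a.y ^ 2) := by rw [a.prop_x]
  rw [Int.even_pow' two_ne_zero, Int.even_add, Int.even_mul, Int.even_pow' two_ne_zero] at h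
  have h1 : ¬ Even (1 : ℤ) := Int.not_even_one
  have h2 : ¬ Even d := Int.not_even_iff_odd.2 hd
  rw [← Int.not_even_iff_odd]
  tauto

/-- **Even `d`: every solution has `x` odd** (`x² = 1 + d·y²` is odd) — no theta-secant parameter (`m = x` even) reaches `ℚ(√-d)` for even `d`
(cf. `mod_four_eq_three_of_even_of_pell`). [bookkeeping] -/
theorem pell_odd_x_of_even_d {d : ℤ} (hd : Even d) (a : Solution₁ d) : Odd a.x := by
  have h : Odd (a.x ^ 2) := by
    rw [a.prop_x, Int.odd_add]
    exact ⟨fun _ ↦ hd.mul_right _, fun _ ↦ odd_one⟩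
  exact (Int.odd_pow' two_ne_zero).1 h

/-! ## §2 The reach law: some solution has `x` even iff the fundamental solution has (`x` even ⟺) `y` odd -/

/-- **THE LAW (solution form).** For odd `d` and the fundamental solution `a₁`: some solution of `x² − d·y² = 1` has `x` even iff `a₁.x` is
even. (⟸ is trivial; ⟹: if `a₁.x` were odd then `a₁.y` is even, hence — every solution being `± a₁ⁿ` — every `y` is even
(`pell_even_y_of_isFundamental`) and every `x` odd.) [bookkeeping] -/
theorem pell_exists_even_x_iff_isFundamental {d : ℤ} (hd : Odd d) {a₁ : Solution₁ d} (h : IsFundamental a₁) :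
    (∃ a : Solution₁ d, Even a.x) ↔ Even a₁.x := by
  refine ⟨fun ⟨a, ha⟩ ↦ ?_, fun hx ↦ ⟨a₁, hx⟩⟩
  by_contra hx
  have hy₁ : Even a₁.y := by
    rw [pell_even_x_iff_odd_y hd] at hx
    exact Int.not_odd_iff_even.1 hx
  exact (Int.not_odd_iff_even.2 (pell_even_y_of_isFundamental h hy₁ a)) ((pell_even_x_iff_odd_y hd a).1 ha)

/-- A witness `m² = d·k² + 1` in ℕ is a Pell solution over ℤ. [bookkeeping] -/
theorem pell_prop_of_nat {d m k : ℕ} (h : m ^ 2 = d * k ^ 2 + 1) : (m : ℤ) ^ 2 - d * (k : ℤ) ^ 2 = 1 := by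
  have hz : ((m ^ 2 : ℕ) : ℤ) = ((d * k ^ 2 + 1 : ℕ) : ℤ) := by exact_mod_cast h
  push_cast at hz
  linarith

/-- **THE LAW (the cell's ℕ-currency).** For odd `d` with fundamental solution `a₁`: «some EVEN `m` has `m² = d·k² + 1`» — i.e. some theta-secant
parameter `m` gives `ψ₀² = -(m² − 1) = -(k²·d)`, field `ℚ(√-d)` — iff `a₁.x` is even. [bookkeeping] -/
theorem thetaSecant_reach_iff_even_fundamental_x {d : ℕ} (hd : Odd d) {a₁ : Solution₁ (d : ℤ)} (h : IsFundamental a₁) :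
    (∃ m k : ℕ, Even m ∧ m ^ 2 = d * k ^ 2 + 1) ↔ Even a₁.x := by
  have hd' : Odd (d : ℤ) := (Int.odd_coe_nat d).2 hd
  rw [← pell_exists_even_x_iff_isFundamental hd' h]
  constructor
  · rintro ⟨m, k, hm, hmk⟩
    exact ⟨Solution₁.mk m k (pell_prop_of_nat hmk), by rw [Solution₁.x_mk]; exact (Int.even_coe_nat m).2 hm⟩
  · rintro ⟨a, ha⟩
    refine ⟨a.x.natAbs, a.y.natAbs, Int.natAbs_even.2 ha, ?_⟩
    have h1 : ((a.x.natAbs ^ 2 : ℕ) : ℤ) = ((d * a.y.natAbs ^ 2 + 1 : ℕ) : ℤ) := by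
      push_cast
      rw [sq_abs, sq_abs, a.prop_x]
      ring
    exact_mod_cast h1

/-- **THE LAW as printed** («iff the fundamental solution of `x² − dy² = 1` has `y` odd»; THETA-SECANT-p1 §1 COVERAGE (Pell)): for odd `d` with
fundamental solution `a₁`, some even `m` has `m² = d·k² + 1` iff `a₁.y` is odd. [bookkeeping] -/
theorem thetaSecant_reach_iff_odd_fundamental_y {d : ℕ} (hd : Odd d) {a₁ : Solution₁ (d : ℤ)} (h : IsFundamental a₁) :
    (∃ m k : ℕ, Even m ∧ m ^ 2 = d * k ^ 2 + 1) ↔ Odd a₁.y := by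
  rw [thetaSecant_reach_iff_even_fundamental_x hd h, pell_even_x_iff_odd_y ((Int.odd_coe_nat d).2 hd)]

/-- **The NO half in general** (the predecessor's `thetaSecant_noList` for `d ∈ {39, 55, 95, 111}` is the instance `y₁ ∈ {4, 12, 4, 28}`): for odd
`d`, if the fundamental solution has `y` even then NO `m² = d·k² + 1` has `m` even (equivalently, every such `k` is even). [bookkeeping] -/
theorem thetaSecant_noReach_of_even_fundamental_y {d : ℕ} (hd : Odd d) {a₁ : Solution₁ (d : ℤ)} (h : IsFundamental a₁)
    (hy : Even a₁.y) {m k : ℕ} (hmk : m ^ 2 = d * k ^ 2 + 1) : ¬ Even m ∧ Even k := by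
  have hm : ¬ Even m := fun hm ↦
    (Int.not_odd_iff_even.2 hy) ((thetaSecant_reach_iff_odd_fundamental_y hd h).1 ⟨m, k, hm, hmk⟩)
  refine ⟨hm, ?_⟩
  have := pell_even_y_of_isFundamental h hy (Solution₁.mk m k (pell_prop_of_nat hmk))
  rw [Solution₁.y_mk] at this
  exact (Int.even_coe_nat k).1 this

/-- **The least reaching parameter is the fundamental `x₁`**: every even `m` with `m² = d·k² + 1` satisfies `a₁.x ≤ m` (minimality of the fundamental
solution among solutions with `x > 1`; an even `m` with `m² = d·k² + 1` has `m ≥ 2`). E.g. `d = 19`: the first `𝓕_m` reaching `ℚ(√-19)` is `m = 170`.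
[bookkeeping] -/
theorem thetaSecant_fundamental_x_le_of_reach {d : ℕ} {a₁ : Solution₁ (d : ℤ)} (h : IsFundamental a₁) {m k : ℕ} (hm : Even m)
    (hmk : m ^ 2 = d * k ^ 2 + 1) : a₁.x ≤ m := by
  have hm0 : m ≠ 0 := by rintro rfl; simp at hmk
  have hm1 : m ≠ 1 := by rintro rfl; exact Nat.not_even_one hm
  have hlt : (1 : ℤ) < ((Solution₁.mk m k (pell_prop_of_nat hmk)).x) := by
    rw [Solution₁.x_mk]; exact_mod_cast (show 1 < m by omega)
  simpa only [Solution₁.x_mk] using h.2.2 hlt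

/-- **`d ≡ 3 (mod 4)` ⟹ a fundamental solution EXISTS** (`d > 0` and `d` is not a square, squares being `≡ 0, 1 (mod 4)`; Mathlib
`Pell.IsFundamental.exists_of_not_isSquare`). [bookkeeping] -/
theorem pell_exists_isFundamental_of_mod_four_eq_three {d : ℕ} (hd : d % 4 = 3) : ∃ a₁ : Solution₁ (d : ℤ), IsFundamental a₁ := by
  refine IsFundamental.exists_of_not_isSquare (by exact_mod_cast (show 0 < d by omega)) ?_
  rintro ⟨r, hr⟩
  rcases Int.even_or_odd r with ⟨s, rfl⟩ | ho
  · have h4 : (4 : ℤ) ∣ (d : ℤ) := ⟨s * s, by rw [hr]; ring⟩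
    have := Int.natCast_dvd_natCast.1 (show ((4 : ℕ) : ℤ) ∣ (d : ℤ) by exact_mod_cast h4)
    omega
  · have h1 : (d : ℤ) % 4 = 1 := by rw [hr, ← sq]; exact Int.sq_mod_four_eq_one_of_odd ho
    omega

/-- **THE PRINTED CRITERION, verbatim, for every `d ≡ 3 (mod 4)`**: «`ℚ(√-d)` is reached by some `𝓕_m`» (some even `m` with `m² = d·k² + 1`) iff
the fundamental solution of `x² − d·y² = 1` (which exists and is unique) has `y` odd. [bookkeeping] -/
theorem thetaSecant_reach_iff_exists_oddFundamental {d : ℕ} (hd : d % 4 = 3) :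
    (∃ m k : ℕ, Even m ∧ m ^ 2 = d * k ^ 2 + 1) ↔ ∃ a₁ : Solution₁ (d : ℤ), IsFundamental a₁ ∧ Odd a₁.y := by
  obtain ⟨a₁, h⟩ := pell_exists_isFundamental_of_mod_four_eq_three hd
  rw [thetaSecant_reach_iff_odd_fundamental_y (Nat.odd_iff.2 (Nat.odd_of_mod_four_eq_three hd)) h]
  exact ⟨fun hy ↦ ⟨a₁, h, hy⟩, fun ⟨b, hb, hby⟩ ↦ (h.subsingleton hb) ▸ hby⟩

/-! ## §3 Which parameters reach: exactly the odd powers of the fundamental solution -/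

/-- **Parities along the powers**: if `d` is odd and `a₁.x` is even (so `a₁.y` is odd), then `(a₁ⁿ).x` is even iff `n` is odd, and `(a₁ⁿ).y` is odd
iff `n` is odd — modulo 2, `(x_{n+1}, y_{n+1}) ≡ (y_n, x_n)`. [bookkeeping] -/
theorem pell_even_x_pow_iff {d : ℤ} (hd : Odd d) {a₁ : Solution₁ d} (hx : Even a₁.x) (n : ℕ) :
    (Even (a₁ ^ n).x ↔ Odd n) ∧ (Odd (a₁ ^ n).y ↔ Odd n) := by
  have hy : ¬ Even a₁.y := Int.not_even_iff_odd.2 ((pell_even_x_iff_odd_y hd a₁).1 hx)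
  have hd' : ¬ Even d := Int.not_even_iff_odd.2 hd
  induction n with
  | zero => simp [Solution₁.x_one, Solution₁.y_one]
  | succ n ih =>
    obtain ⟨ihx, ihy⟩ := ih
    rw [← Int.not_even_iff_odd] at ihy
    rw [pow_succ, Solution₁.x_mul, Solution₁.y_mul, Nat.odd_add_one, ← Int.not_even_iff_odd, Int.even_add, Int.even_mul,
      Int.even_mul, Int.even_mul, Int.even_add, Int.even_mul, Int.even_mul]
    constructor
    · tauto
    · tauto

/-- Integer-power form of `pell_even_x_pow_iff`: `(a₁ ^ n).x` is even iff `n` is odd, for every `n : ℤ`. [bookkeeping] -/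
theorem pell_even_x_zpow_iff {d : ℤ} (hd : Odd d) {a₁ : Solution₁ d} (hx : Even a₁.x) (n : ℤ) : Even (a₁ ^ n).x ↔ Odd n := by
  cases n with
  | ofNat n =>
    rw [Int.ofNat_eq_natCast, zpow_natCast, Int.odd_coe_nat]
    exact (pell_even_x_pow_iff hd hx n).1
  | negSucc n =>
    rw [zpow_negSucc, Solution₁.x_inv, (pell_even_x_pow_iff hd hx (n + 1)).1, Int.negSucc_eq, odd_neg]
    norm_cast

/-- **WHICH solutions have even `x`**: for odd `d` and a fundamental solution with even `x`, a solution has `x` even iff it is `± a₁ⁿ` with `n`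
ODD — so the theta-secant parameters reaching `ℚ(√-d)` are exactly `m = x_n(d)` for odd `n` (`m = x₁ < x₃ < x₅ < ⋯`). [bookkeeping] -/
theorem pell_even_x_iff_odd_exponent {d : ℤ} (hd : Odd d) {a₁ : Solution₁ d} (h : IsFundamental a₁) (hx : Even a₁.x)
    (a : Solution₁ d) : Even a.x ↔ ∃ n : ℤ, Odd n ∧ (a = a₁ ^ n ∨ a = -a₁ ^ n) := by
  constructor
  · intro ha
    obtain ⟨n, hn⟩ := h.eq_zpow_or_neg_zpow a
    refine ⟨n, ?_, hn⟩
    rcases hn with rfl | rfl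
    · exact (pell_even_x_zpow_iff hd hx n).1 ha
    · rw [Solution₁.x_neg, even_neg] at ha
      exact (pell_even_x_zpow_iff hd hx n).1 ha
  · rintro ⟨n, hn, rfl | rfl⟩
    · exact (pell_even_x_zpow_iff hd hx n).2 hn
    · rw [Solution₁.x_neg, even_neg]
      exact (pell_even_x_zpow_iff hd hx n).2 hn

/-! ## §4 Beyond the table: every prime `p ≡ 3 (mod 4)` is reached -/

/-- **Prime `p ≡ 3 (mod 4)`: the fundamental solution of `x² − p·y² = 1` has `x` EVEN.** Classical descent: were `x = 2t + 1` odd, then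
`y = 2w` and `t·(t + 1) = p·w²` with `t, t + 1` coprime; either `t = p·a²`, `t + 1 = b²`, and `(b, a)` is a solution with `1 < b < x`
(contradicting minimality), or `t = a²`, `p ∣ t + 1`, and `a² ≡ -1 (mod p)`, impossible for `p ≡ 3 (mod 4)`. [bookkeeping] -/
theorem pell_even_x_of_isFundamental_of_prime {p : ℕ} (hp : p.Prime) (hp4 : p % 4 = 3) {a₁ : Solution₁ (p : ℤ)}
    (h : IsFundamental a₁) : Even a₁.x := by
  haveI := Fact.mk hp
  have hpodd : Odd (p : ℤ) := (Int.odd_coe_nat p).2 (Nat.odd_iff.2 (Nat.odd_of_mod_four_eq_three hp4))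
  have hp0 : (p : ℤ) ≠ 0 := by exact_mod_cast hp.ne_zero
  by_contra hx
  have hyeven : Even a₁.y := by
    rw [pell_even_x_iff_odd_y hpodd] at hx
    exact Int.not_odd_iff_even.1 hx
  obtain ⟨t, ht⟩ := Int.not_even_iff_odd.1 hx
  obtain ⟨w, hw⟩ := hyeven
  have hx1 := h.1
  have ht0 : 0 < t := by linarith
  have key : t * (t + 1) = p * w ^ 2 := by
    have e := a₁.prop
    rw [ht, hw] at e
    have e4 : (4 : ℤ) * (t * (t + 1)) = 4 * (p * w ^ 2) := by linear_combination e
    exact mul_left_cancel₀ (by norm_num) e4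
  have hpprime : Prime (p : ℤ) := Nat.prime_iff_prime_int.1 hp
  rcases hpprime.dvd_or_dvd (⟨w ^ 2, key⟩ : (p : ℤ) ∣ t * (t + 1)) with ⟨s, hs⟩ | ⟨s, hs⟩
  · -- `t = p·s`: then `(t + 1)·s = w²` with `t + 1, s` coprime ⟹ `t + 1 = b²`, `s = c²`, and `b² − p·c² = 1` is a smaller solution.
    have hprod : (t + 1) * s = w ^ 2 := by
      have e : (p : ℤ) * ((t + 1) * s) = p * w ^ 2 := by rw [← key, hs]; ring
      exact mul_left_cancel₀ hp0 e
    have hcop : Int.gcd (t + 1) s = 1 := Int.isCoprime_iff_gcd_eq_one.1 ⟨1, -(p : ℤ), by linear_combination hs⟩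
    have hcop' : Int.gcd s (t + 1) = 1 := by rw [Int.gcd_comm]; exact hcop
    obtain ⟨b, hb⟩ := Int.sq_of_gcd_eq_one hcop hprod
    obtain ⟨c, hc⟩ := Int.sq_of_gcd_eq_one hcop' (by rw [mul_comm]; exact hprod)
    have htb : t + 1 = b ^ 2 := by
      rcases hb with hb | hb
      · exact hb
      · nlinarith [sq_nonneg b]
    have hs0 : 0 < s := by
      have hps : (0 : ℤ) < p * s := by rw [← hs]; exact ht0
      have hp_pos : (0 : ℤ) < p := by exact_mod_cast hp.pos
      by_contra hle
      push Not at hle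
      nlinarith
    have hsc : s = c ^ 2 := by
      rcases hc with hc | hc
      · exact hc
      · nlinarith [sq_nonneg c]
    -- the smaller solution `(|b|, c)`
    have hsol : (|b|) ^ 2 - (p : ℤ) * c ^ 2 = 1 := by rw [sq_abs, ← htb, ← hsc, ← hs]; ring
    have hb1 : 1 < |b| := by
      by_contra hle
      push Not at hle
      have : |b| ^ 2 ≤ 1 := by nlinarith [abs_nonneg b]
      rw [sq_abs] at this
      linarith
    have hmin := h.2.2 (show 1 < (Solution₁.mk |b| c hsol).x by rw [Solution₁.x_mk]; exact hb1)
    rw [Solution₁.x_mk] at hmin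
    -- `x = 2t + 1 ≤ |b| ≤ |b|² = t + 1`: contradiction with `t > 0`
    have hbb : |b| ≤ |b| ^ 2 := by nlinarith [abs_nonneg b]
    rw [sq_abs] at hbb
    linarith
  · -- `t + 1 = p·s`: then `t·s = w²` with `t, s` coprime ⟹ `t = a²`, and `a² + 1 ≡ 0 (mod p)`.
    have hprod : t * s = w ^ 2 := by
      have e : (p : ℤ) * (t * s) = p * w ^ 2 := by rw [← key, hs]; ring
      exact mul_left_cancel₀ hp0 e
    have hcop : Int.gcd t s = 1 := Int.isCoprime_iff_gcd_eq_one.1 ⟨-1, (p : ℤ), by linear_combination (-1 : ℤ) * hs⟩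
    obtain ⟨a, ha⟩ := Int.sq_of_gcd_eq_one hcop hprod
    have hta : t = a ^ 2 := by
      rcases ha with ha | ha
      · exact ha
      · nlinarith [sq_nonneg a]
    have hmod : ((a : ZMod p)) ^ 2 = -1 := by
      have h1 : (((a ^ 2 + 1 : ℤ)) : ZMod p) = (((p * s : ℤ)) : ZMod p) := by rw [← hs, hta]
      push_cast at h1
      rw [ZMod.natCast_self, zero_mul] at h1
      linear_combination h1
    exact ZMod.mod_four_ne_three_of_sq_eq_neg_one hmod hp4

/-- **Every prime `p ≡ 3 (mod 4)` is reached**: some EVEN `m` and ODD `k` satisfy `m² = p·k² + 1`, so some theta-secant parameter has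
`ψ₀² = -(m² − 1) = -(k²·p)` and field `ℚ(√-p)` — for ALL such `p`, beyond the `d ≤ 119` table, with no computation. [bookkeeping] -/
theorem thetaSecant_reaches_prime {p : ℕ} (hp : p.Prime) (hp4 : p % 4 = 3) : ∃ m k : ℕ, Even m ∧ Odd k ∧ m ^ 2 = p * k ^ 2 + 1 := by
  obtain ⟨a₁, h⟩ := pell_exists_isFundamental_of_mod_four_eq_three hp4
  obtain ⟨m, k, hm, hmk⟩ := (thetaSecant_reach_iff_even_fundamental_x (Nat.odd_iff.2 (Nat.odd_of_mod_four_eq_three hp4)) h).2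
    (pell_even_x_of_isFundamental_of_prime hp hp4 h)
  exact ⟨m, k, hm, Nat.odd_iff.2 (mod_four_eq_three_of_even_of_pell hm hmk).2, hmk⟩

/-- **The next primes after the table** (`d ≤ 119` ends with the prime `107`): `ℚ(√-p)` is reached for `p = 127, 131, 139, 151, 163, 167, 179, 191,
199` — instances of `thetaSecant_reaches_prime`, primality by `norm_num`. [bookkeeping] -/
theorem thetaSecant_reaches_primes_beyond_table :
    ∀ p ∈ ([127, 131, 139, 151, 163, 167, 179, 191, 199] : List ℕ), ∃ m k : ℕ, Even m ∧ Odd k ∧ m ^ 2 = p * k ^ 2 + 1 := by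
  intro p hp
  simp only [List.mem_cons, List.mem_nil_iff, or_false] at hp
  rcases hp with rfl | rfl | rfl | rfl | rfl | rfl | rfl | rfl | rfl <;>
    exact thetaSecant_reaches_prime (by norm_num) (by norm_num)

end PellLaw

/-! ## §5 Compositions: which fourfold fields the theta-secant family reaches, closed form -/

section Reach

open Pell
open Summit.HodgeConjecture.HodgeConjecture
open Summit.HodgeConjecture.HodgeConjecture.WeilTypeLadder
open Summit.HodgeConjecture.HodgeConjecture.Cruxes.HodgeAbelianVarieties.EStepSecantInduction
open Summit.Ventures.HSemireg.GeneralStructure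

variable {C : ChernCharacterBetti}

/-- **CLOSED-FORM REACH (extrapolating the m-uniform mechanism; tier of `hrow` as in `weilAlgebraicAll_two_pellList_…`): if the theta-secant
construction is a hyperbolic rank-class seed at level 3 with `ψ₀² = -(m² − 1)` for EVERY even `m ≥ 2` (`hrow`, BY VALUE), then for every odd
`d` whose fundamental Pell solution has `y` ODD, ALL `ℚ(√-d)`-Weil abelian FOURFOLDS have algebraic Weil classes** — under
`weilFamilyReach_hyperbolic` ∧ `PerfectComplexRankTransfer C` BY NAME. The reaching `m` is supplied by §2, `m² − 1 = k²·d`, and the square descends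
(seat p8 gen 0's `…_hyperbolicSeedOn_three_sq_mul`). In print: [Markman2025SecantWeil] Cor. 1.6.1 (PREPRINT, every `d`). Nothing about non-split
sixfolds. [cite: Markman2025SecantWeil, Cor. 1.6.1 (preprint)] [cite: Deligne1982HodgeCycles, proof of Thm. 4.8] -/
theorem weilAlgebraicAll_two_of_reach_of_perfectComplexRankTransfer_of_thetaSecantSeeds_of_oddFundamental
    (hF : weilFamilyReach_hyperbolic) (hT : PerfectComplexRankTransfer C)
    (hrow : ∀ m : ℕ, Even m → 2 ≤ m → HasHyperbolicSeedOn (rankObjClass C) 3 (m ^ 2 - 1))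
    {d : ℕ} (hd : Odd d) {a₁ : Solution₁ (d : ℤ)} (h : IsFundamental a₁) (hy : Odd a₁.y) : WeilAlgebraicAll 2 d := by
  obtain ⟨m, k, hm, hmk⟩ := (thetaSecant_reach_iff_odd_fundamental_y hd h).2 hy
  have hk : 0 < k := by have := (mod_four_eq_three_of_even_of_pell hm hmk).2; omega
  have h2m : 2 ≤ m := by
    have hm0 : m ≠ 0 := by rintro rfl; simp at hmk
    have hm1 : m ≠ 1 := by rintro rfl; exact Nat.not_even_one hm
    omega
  have hS : HasHyperbolicSeedOn (rankObjClass C) 3 (k ^ 2 * d) := by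
    have h' : m ^ 2 - 1 = k ^ 2 * d := by rw [hmk]; ring_nf; omega
    exact h' ▸ hrow m hm h2m
  exact (weilAlgebraicAll_two_of_reach_of_perfectComplexRankTransfer_of_hyperbolicSeedOn_three_sq_mul hF hT hk hd.pos hS).1

/-- **EVERY PRIME `p ≡ 3 (mod 4)`** (same hypotheses and tier): ALL `ℚ(√-p)`-Weil abelian FOURFOLDS have algebraic Weil classes — the theta-secant
family reaches `ℚ(√-p)` by §4, with no table. In print: [Markman2025SecantWeil] Cor. 1.6.1 (PREPRINT); `p = 3` refereed ([Schoen1988HodgeWeil]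
Thm. 3.2 + [Schoen1998HodgeWeilAddendum]). Nothing about non-split sixfolds, `ℚ(i)`, or composite `d` (§2 decides those by `y₁`).
[cite: Markman2025SecantWeil, Cor. 1.6.1 (preprint)] [cite: Schoen1998HodgeWeilAddendum, §10] [cite: Deligne1982HodgeCycles, proof of Thm. 4.8] -/
theorem weilAlgebraicAll_two_prime_of_reach_of_perfectComplexRankTransfer_of_thetaSecantSeeds
    (hF : weilFamilyReach_hyperbolic) (hT : PerfectComplexRankTransfer C)
    (hrow : ∀ m : ℕ, Even m → 2 ≤ m → HasHyperbolicSeedOn (rankObjClass C) 3 (m ^ 2 - 1))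
    {p : ℕ} (hp : p.Prime) (hp4 : p % 4 = 3) : WeilAlgebraicAll 2 p := by
  obtain ⟨a₁, h⟩ := pell_exists_isFundamental_of_mod_four_eq_three hp4
  have hd : Odd p := Nat.odd_iff.2 (Nat.odd_of_mod_four_eq_three hp4)
  exact weilAlgebraicAll_two_of_reach_of_perfectComplexRankTransfer_of_thetaSecantSeeds_of_oddFundamental hF hT hrow hd h
    ((pell_even_x_iff_odd_y ((Int.odd_coe_nat p).2 hd) a₁).1 (pell_even_x_of_isFundamental_of_prime hp hp4 h))

end Reach

/-! ## Audit: nothing is decided here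
KERNEL: §1 parity of Pell solutions, §2 the reach law «some even `x` ⟺ fundamental `y` odd» (+ existence for `d ≡ 3 (mod 4)`, minimality of `x₁`),
§3 the reaching solutions are `± a₁ⁿ`, `n` odd, §4 primes `p ≡ 3 (mod 4)` have fundamental `x` even (descent + `-1` non-residue), §5 two compositions
with the landed cell theorem. BY NAME: `weilFamilyReach_hyperbolic`, `PerfectComplexRankTransfer C`. BY VALUE: the theta-secant rows as level-3
hyperbolic rank-class seeds uniformly in even `m` (an extrapolation beyond the rows of record, as labelled in the predecessor file). Not here: any
non-split sixfold, HC_CM, `σ ∘ ob = ⌟ch`; composite `d` beyond `119` are decided by `y₁(d)` (§2) but not tabulated. -/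

end Summit.Ventures.HSemireg

end
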